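import Literature.Topology.FourManifolds.SphereFamilySurgery
import Literature.Topology.FourManifolds.CircleSurgeryExistence
import Literature.Topology.FourManifolds.ImmersionOrientation
import Mathlib.Geometry.Manifold.Instances.Sphere
import HarnessLib

/-!
# Cylinder frames of a spherical modification, I: the cone of a framed sphere and its differential

Topic `Literature/Topology/FourManifolds` (fact seat of
`Literature.Topology.FourManifolds.HomotopySphere.boundsContractible_of_nullCobordism_isStablyParallelizable_four`;
towards Kervaire–Milnor's Lemma 5.4 / 6.2).  For a framed `k`-sphere `φ : Sᵏ × ℝᵐ ↪ X` of a
framed family `ν` the **cone** `φ̂ : (ℝᵏ⁺¹ ∖ 0) × ℝᵐ → X`, `φ̂(z, w) = φ(z/‖z‖, w)`, is the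
parametrisation of the tube by an open subset of the vector space `E = ℝᵏ⁺¹ × ℝᵐ` through
which the tube framing of `T X ⊕ ℝ` is read (`SurgerySwapMatrix.lean`: the cylinder frame
`cylT p h L` for the differential `L = dφ̂`):

* `FramedSphereFamily.cone`, `cone_apply_coe`, `cone_smul` (constant along rays), `contMDiffOn_cone`;
* `FramedSphereFamily.coneDeriv u w = dφ̂_{(u, w)} : E →L T_{φ(u,w)} X` and its three properties:
  `coneDeriv_apply_normal` (**`dφ̂ (u, 0) = 0`**, the cone is constant along rays),
  `coneDeriv_comp_eq` (**`dφ̂ ∘ d(incl × id) = dφ`** on the hypersurface `Sᵏ × ℝᵐ`), and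
  `eq_zero_of_coneDeriv_eq_zero` (**`dφ̂` is injective on the hyperplane `⟪u, ·⟫ = 0`**, because
  `dφ` is injective and `d(incl)_u` maps onto `u^⊥`, Mathlib's `range_mfderiv_coe_sphere`).

Everything is proved; `cone`, `coneDeriv` are explicit definitions; no named facts.

## References

* M. Kervaire, J. Milnor, *Groups of homotopy spheres I*, Ann. of Math. (2) 77 (1963), §6
  pp. 520–522. doi:10.2307/1970128 [KervaireMilnorAnnals1963]
* A. Kosinski, *Differential Manifolds* (1993), Ch. X §2, Lemma (2.1), p. 200. [Kosinski1993]
-/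

noncomputable section

open scoped Manifold ContDiff Topology RealInnerProductSpace
open Set Function Bundle Metric Module

namespace Literature.Topology.FourManifolds

namespace FramedSphereFamily

universe u

attribute [local instance] fact_finrank_euclideanSpace_succ

section Cone

variable {EX HX : Type*} [NormedAddCommGroup EX] [NormedSpace ℝ EX] [TopologicalSpace HX]
  {IX : ModelWithCorners ℝ EX HX} {X : Type u} [TopologicalSpace X] [ChartedSpace HX X]
  {ι : Type u} {k m : ℕ}
  (ν : FramedSphereFamily IX X ι k m) (i : ι)

/-- **The cone of a framed sphere**: `φ̂ᵢ(z, w) = φᵢ(z/‖z‖, w)` on `ℝᵏ⁺¹ × ℝᵐ` (junk on `z = 0`),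
the parametrisation of the `i`-th tube by an open subset of the vector space `ℝᵏ⁺¹ × ℝᵐ`.
[cite: Kosinski1993, Ch. X §2, Lemma (2.1)] -/
def cone (q : EuclideanSpace ℝ (Fin (k + 1)) × EuclideanSpace ℝ (Fin m)) : X :=
  ν.toFun i (radialProjection (spherePt k) q.1, q.2)

/-- On the hypersurface `Sᵏ × ℝᵐ` the cone is the framed sphere. [folklore] -/
@[simp] theorem cone_apply_coe (u : Metric.sphere (0 : EuclideanSpace ℝ (Fin (k + 1))) 1)
    (w : EuclideanSpace ℝ (Fin m)) :
    ν.cone i ((u : EuclideanSpace ℝ (Fin (k + 1))), w) = ν.toFun i (u, w) := by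
  simp [cone, radialProjection_coe_sphere]

/-- The cone is constant along the rays `c ↦ (c • z, w)`, `c > 0`. [folklore] -/
theorem cone_smul {c : ℝ} (hc : 0 < c) (u : Metric.sphere (0 : EuclideanSpace ℝ (Fin (k + 1))) 1)
    (w : EuclideanSpace ℝ (Fin m)) :
    ν.cone i (c • (u : EuclideanSpace ℝ (Fin (k + 1))), w) = ν.toFun i (u, w) := by
  simp [cone, radialProjection_smul _ hc]

/-- The cone is `C^∞` off `z = 0`. [folklore] -/
theorem contMDiffOn_cone :
    ContMDiffOn ((𝓘(ℝ, EuclideanSpace ℝ (Fin (k + 1)))).prod 𝓘(ℝ, EuclideanSpace ℝ (Fin m))) IX ∞ (ν.cone i)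
      {q | q.1 ≠ 0} := by
  have h1 : ContMDiffOn ((𝓘(ℝ, EuclideanSpace ℝ (Fin (k + 1)))).prod 𝓘(ℝ, EuclideanSpace ℝ (Fin m)))
      ((𝓡 k).prod 𝓘(ℝ, EuclideanSpace ℝ (Fin m))) ∞
      (fun q : EuclideanSpace ℝ (Fin (k + 1)) × EuclideanSpace ℝ (Fin m) =>
        (radialProjection (spherePt k) q.1, q.2)) {q | q.1 ≠ 0} := by
    refine ContMDiffOn.prodMk ?_ contMDiff_snd.contMDiffOn
    exact (contMDiffOn_radialProjection (spherePt k)).comp contMDiff_fst.contMDiffOn fun q hq => hq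
  exact (ν.contMDiff i).comp_contMDiffOn h1

/-- The cone is differentiable at the points off `z = 0`. [folklore] -/
theorem mdifferentiableAt_cone {q : EuclideanSpace ℝ (Fin (k + 1)) × EuclideanSpace ℝ (Fin m)}
    (hq : q.1 ≠ 0) :
    MDifferentiableAt ((𝓘(ℝ, EuclideanSpace ℝ (Fin (k + 1)))).prod 𝓘(ℝ, EuclideanSpace ℝ (Fin m))) IX (ν.cone i) q :=
  ((ν.contMDiffOn_cone i).contMDiffAt
    ((isOpen_ne.preimage continuous_fst).mem_nhds hq)).mdifferentiableAt (by simp)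

/-- **The differential of the cone** `dφ̂ᵢ` at the point `(u, w)` of the hypersurface, a linear
map `ℝᵏ⁺¹ × ℝᵐ → T_{φᵢ(u, w)} X` (the `L` of `SurgerySwapMatrix.cylT`).
[cite: Kosinski1993, Ch. X §2, Lemma (2.1)] -/
def coneDeriv (u : Metric.sphere (0 : EuclideanSpace ℝ (Fin (k + 1))) 1) (w : EuclideanSpace ℝ (Fin m)) :
    (EuclideanSpace ℝ (Fin (k + 1)) × EuclideanSpace ℝ (Fin m)) →L[ℝ] EX :=
  mfderiv ((𝓘(ℝ, EuclideanSpace ℝ (Fin (k + 1)))).prod 𝓘(ℝ, EuclideanSpace ℝ (Fin m))) IX (ν.cone i)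
    ((u : EuclideanSpace ℝ (Fin (k + 1))), w)

/-- **`dφ̂ (u, 0) = 0`**: the cone is constant along rays. [folklore] -/
theorem coneDeriv_apply_normal (u : Metric.sphere (0 : EuclideanSpace ℝ (Fin (k + 1))) 1)
    (w : EuclideanSpace ℝ (Fin m)) :
    ν.coneDeriv i u w ((u : EuclideanSpace ℝ (Fin (k + 1))), 0) = 0 := by
  have hu0 : (u : EuclideanSpace ℝ (Fin (k + 1))) ≠ 0 := ne_zero_of_mem_unit_sphere u
  -- the ray through `(u, w)`
  set γ : ℝ → EuclideanSpace ℝ (Fin (k + 1)) × EuclideanSpace ℝ (Fin m) :=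
    fun t => ((1 + t) • (u : EuclideanSpace ℝ (Fin (k + 1))), w) with hγ
  have hγ0 : γ 0 = ((u : EuclideanSpace ℝ (Fin (k + 1))), w) := by simp [hγ]
  set D : ℝ →L[ℝ] EuclideanSpace ℝ (Fin (k + 1)) × EuclideanSpace ℝ (Fin m) :=
    ((ContinuousLinearMap.id ℝ ℝ).smulRight (u : EuclideanSpace ℝ (Fin (k + 1)))).prod
      (0 : ℝ →L[ℝ] EuclideanSpace ℝ (Fin m)) with hD
  have hγm : HasMFDerivAt 𝓘(ℝ, ℝ) ((𝓘(ℝ, EuclideanSpace ℝ (Fin (k + 1)))).prod 𝓘(ℝ, EuclideanSpace ℝ (Fin m))) γ 0 D := by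
    have h1 : HasFDerivAt (fun t : ℝ => (1 + t) • (u : EuclideanSpace ℝ (Fin (k + 1))))
        ((ContinuousLinearMap.id ℝ ℝ).smulRight (u : EuclideanSpace ℝ (Fin (k + 1)))) 0 :=
      ((hasFDerivAt_id (0 : ℝ)).const_add 1).smul_const _
    have h2 : HasFDerivAt (fun _ : ℝ => w) (0 : ℝ →L[ℝ] EuclideanSpace ℝ (Fin m)) 0 :=
      hasFDerivAt_const w 0
    exact (hasMFDerivAt_iff_hasFDerivAt.2 h1).prodMk (hasMFDerivAt_iff_hasFDerivAt.2 h2)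
  -- the cone is constant along the ray near `t = 0`
  have hconst : (ν.cone i ∘ γ) =ᶠ[𝓝 0] fun _ => ν.toFun i (u, w) := by
    have : Ioi (-1 : ℝ) ∈ 𝓝 (0 : ℝ) := Ioi_mem_nhds (by norm_num)
    filter_upwards [this] with t ht
    simp only [comp_apply, hγ]
    exact ν.cone_smul i (by linarith [mem_Ioi.1 ht]) u w
  have h1 : HasMFDerivAt 𝓘(ℝ, ℝ) IX (ν.cone i ∘ γ) 0 ((ν.coneDeriv i u w).comp D) := by
    have hd := (ν.mdifferentiableAt_cone i (q := ((u : EuclideanSpace ℝ (Fin (k + 1))), w)) hu0).hasMFDerivAt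
    have hd' : HasMFDerivAt ((𝓘(ℝ, EuclideanSpace ℝ (Fin (k + 1)))).prod 𝓘(ℝ, EuclideanSpace ℝ (Fin m))) IX (ν.cone i)
        (γ 0) (ν.coneDeriv i u w) := by
      rw [hγ0]
      exact hd
    exact hd'.comp 0 hγm
  have h2 : HasMFDerivAt 𝓘(ℝ, ℝ) IX (ν.cone i ∘ γ) 0
      (0 : TangentSpace 𝓘(ℝ, ℝ) (0 : ℝ) →L[ℝ] TangentSpace IX ((ν.cone i ∘ γ) 0)) :=
    (hasMFDerivAt_const (I := 𝓘(ℝ, ℝ)) (I' := IX) (ν.toFun i (u, w)) 0).congr_of_eventuallyEq hconst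
  have heq := h1.mfderiv.symm.trans h2.mfderiv
  have key : (ν.coneDeriv i u w) (D 1) = 0 := DFunLike.congr_fun heq (1 : ℝ)
  simpa [hD] using key

/-- The inclusion `Sᵏ × ℝᵐ → ℝᵏ⁺¹ × ℝᵐ`. [folklore] -/
def hyp (q : Metric.sphere (0 : EuclideanSpace ℝ (Fin (k + 1))) 1 × EuclideanSpace ℝ (Fin m)) :
    EuclideanSpace ℝ (Fin (k + 1)) × EuclideanSpace ℝ (Fin m) :=
  ((q.1 : EuclideanSpace ℝ (Fin (k + 1))), q.2)

/-- The inclusion of the hypersurface is `C^∞`. [folklore] -/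
theorem contMDiff_hyp :
    ContMDiff ((𝓡 k).prod 𝓘(ℝ, EuclideanSpace ℝ (Fin m)))
      ((𝓘(ℝ, EuclideanSpace ℝ (Fin (k + 1)))).prod 𝓘(ℝ, EuclideanSpace ℝ (Fin m))) ∞ (hyp (k := k) (m := m)) :=
  ((contMDiff_coe_sphere (E := EuclideanSpace ℝ (Fin (k + 1))) (n := k)).comp contMDiff_fst).prodMk
    contMDiff_snd

/-- **`dφ̂ ∘ d(incl × id) = dφ`** at a point of the hypersurface: the cone restricts to the framed
sphere. [folklore] -/
theorem coneDeriv_comp_eq (u : Metric.sphere (0 : EuclideanSpace ℝ (Fin (k + 1))) 1)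
    (w : EuclideanSpace ℝ (Fin m)) :
    (ν.coneDeriv i u w).comp
        (mfderiv ((𝓡 k).prod 𝓘(ℝ, EuclideanSpace ℝ (Fin m)))
          ((𝓘(ℝ, EuclideanSpace ℝ (Fin (k + 1)))).prod 𝓘(ℝ, EuclideanSpace ℝ (Fin m))) hyp (u, w)) =
      mfderiv ((𝓡 k).prod 𝓘(ℝ, EuclideanSpace ℝ (Fin m))) IX (ν.toFun i) (u, w) := by
  have hu0 : (u : EuclideanSpace ℝ (Fin (k + 1))) ≠ 0 := ne_zero_of_mem_unit_sphere u
  have hfun : ν.cone i ∘ hyp = ν.toFun i := funext fun q => ν.cone_apply_coe i q.1 q.2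
  have hhyp : MDifferentiableAt ((𝓡 k).prod 𝓘(ℝ, EuclideanSpace ℝ (Fin m)))
      ((𝓘(ℝ, EuclideanSpace ℝ (Fin (k + 1)))).prod 𝓘(ℝ, EuclideanSpace ℝ (Fin m))) hyp (u, w) :=
    (contMDiff_hyp (u, w)).mdifferentiableAt (by simp)
  have := mfderiv_comp (u, w) (ν.mdifferentiableAt_cone i (q := hyp (u, w)) hu0) hhyp
  rw [hfun] at this
  exact this.symm

/-- The differential of the framed sphere is injective (a smooth embedding is an immersion).
[folklore] -/
theorem injective_mfderiv_toFun (q : Metric.sphere (0 : EuclideanSpace ℝ (Fin (k + 1))) 1 × EuclideanSpace ℝ (Fin m)) :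
    Injective (mfderiv ((𝓡 k).prod 𝓘(ℝ, EuclideanSpace ℝ (Fin m))) IX (ν.toFun i) q) := by
  obtain ⟨F, _, _, hF⟩ := (ν.isSmoothEmbedding i).isImmersion
  exact injective_mfderiv_of_isImmersionAtOfComplement' (hF q)

/-- The differential of the inclusion of the hypersurface at `(u, w)` is `d(incl)_u × id`.
[folklore] -/
theorem mfderiv_hyp (u : Metric.sphere (0 : EuclideanSpace ℝ (Fin (k + 1))) 1)
    (w : EuclideanSpace ℝ (Fin m)) :
    mfderiv ((𝓡 k).prod 𝓘(ℝ, EuclideanSpace ℝ (Fin m)))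
        ((𝓘(ℝ, EuclideanSpace ℝ (Fin (k + 1)))).prod 𝓘(ℝ, EuclideanSpace ℝ (Fin m))) hyp (u, w) =
      ((mfderiv (𝓡 k) 𝓘(ℝ, EuclideanSpace ℝ (Fin (k + 1)))
          (Subtype.val : Metric.sphere (0 : EuclideanSpace ℝ (Fin (k + 1))) 1 → _) u).comp
        (ContinuousLinearMap.fst ℝ (EuclideanSpace ℝ (Fin k)) (EuclideanSpace ℝ (Fin m)))).prod
        (ContinuousLinearMap.snd ℝ (EuclideanSpace ℝ (Fin k)) (EuclideanSpace ℝ (Fin m))) := by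
  have hval : MDifferentiableAt (𝓡 k) 𝓘(ℝ, EuclideanSpace ℝ (Fin (k + 1)))
      (Subtype.val : Metric.sphere (0 : EuclideanSpace ℝ (Fin (k + 1))) 1 → _) u :=
    (contMDiff_coe_sphere (m := 1) (n := k) (E := EuclideanSpace ℝ (Fin (k + 1)))).mdifferentiableAt
      one_ne_zero
  have h1 : HasMFDerivAt ((𝓡 k).prod 𝓘(ℝ, EuclideanSpace ℝ (Fin m))) 𝓘(ℝ, EuclideanSpace ℝ (Fin (k + 1)))
      (fun q : Metric.sphere (0 : EuclideanSpace ℝ (Fin (k + 1))) 1 × EuclideanSpace ℝ (Fin m) =>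
        (q.1 : EuclideanSpace ℝ (Fin (k + 1)))) (u, w)
      ((mfderiv (𝓡 k) 𝓘(ℝ, EuclideanSpace ℝ (Fin (k + 1)))
        (Subtype.val : Metric.sphere (0 : EuclideanSpace ℝ (Fin (k + 1))) 1 → _) u).comp
        (ContinuousLinearMap.fst ℝ (EuclideanSpace ℝ (Fin k)) (EuclideanSpace ℝ (Fin m)))) :=
    hval.hasMFDerivAt.comp (u, w)
      (hasMFDerivAt_fst (I := 𝓡 k) (I' := 𝓘(ℝ, EuclideanSpace ℝ (Fin m))) (u, w))
  have h2 : HasMFDerivAt ((𝓡 k).prod 𝓘(ℝ, EuclideanSpace ℝ (Fin m))) 𝓘(ℝ, EuclideanSpace ℝ (Fin m))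
      (fun q : Metric.sphere (0 : EuclideanSpace ℝ (Fin (k + 1))) 1 × EuclideanSpace ℝ (Fin m) => q.2) (u, w)
      (ContinuousLinearMap.snd ℝ (EuclideanSpace ℝ (Fin k)) (EuclideanSpace ℝ (Fin m))) :=
    hasMFDerivAt_snd (I := 𝓡 k) (I' := 𝓘(ℝ, EuclideanSpace ℝ (Fin m))) (u, w)
  unfold hyp
  exact (h1.prodMk h2).mfderiv

/-- Pointwise form: `d(incl × id)_{(u,w)} (ξ, x₂) = (d(incl)_u ξ, x₂)`. [folklore] -/
theorem mfderiv_hyp_apply (u : Metric.sphere (0 : EuclideanSpace ℝ (Fin (k + 1))) 1)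
    (w : EuclideanSpace ℝ (Fin m)) (ξ : EuclideanSpace ℝ (Fin k)) (x₂ : EuclideanSpace ℝ (Fin m)) :
    mfderiv ((𝓡 k).prod 𝓘(ℝ, EuclideanSpace ℝ (Fin m)))
        ((𝓘(ℝ, EuclideanSpace ℝ (Fin (k + 1)))).prod 𝓘(ℝ, EuclideanSpace ℝ (Fin m))) hyp (u, w) (ξ, x₂) =
      (mfderiv (𝓡 k) 𝓘(ℝ, EuclideanSpace ℝ (Fin (k + 1)))
        (Subtype.val : Metric.sphere (0 : EuclideanSpace ℝ (Fin (k + 1))) 1 → _) u ξ, x₂) := by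
  rw [mfderiv_hyp]
  rfl

/-- **`dφ̂` is injective on the hyperplane `⟪u, ·⟫ = 0`** (the `hLi` of
`SurgerySwapMatrix.compMat_cylR_cylT`): a vector `x = (x₁, x₂)` with `x₁ ⊥ u` lifts to a tangent
vector of `Sᵏ × ℝᵐ` (`u^⊥` is the range of `d(incl)_u`, Mathlib's `range_mfderiv_coe_sphere`),
on which `dφ̂` is `dφ`, injective. [folklore] -/
theorem eq_zero_of_coneDeriv_eq_zero (u : Metric.sphere (0 : EuclideanSpace ℝ (Fin (k + 1))) 1)
    (w : EuclideanSpace ℝ (Fin m)) (x : EuclideanSpace ℝ (Fin (k + 1)) × EuclideanSpace ℝ (Fin m))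
    (hx : ⟪(u : EuclideanSpace ℝ (Fin (k + 1))), x.1⟫ = 0) (h0 : ν.coneDeriv i u w x = 0) : x = 0 := by
  -- `x₁ ∈ u^⊥ = range d(incl)_u`
  obtain ⟨ξ, hξ⟩ : ∃ ξ : TangentSpace (𝓡 k) u, mfderiv (𝓡 k) 𝓘(ℝ, EuclideanSpace ℝ (Fin (k + 1)))
      (Subtype.val : Metric.sphere (0 : EuclideanSpace ℝ (Fin (k + 1))) 1 → _) u ξ = x.1 := by
    have hmem : x.1 ∈ (ℝ ∙ (u : EuclideanSpace ℝ (Fin (k + 1))))ᗮ :=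
      Submodule.mem_orthogonal_singleton_iff_inner_right.2 hx
    rw [← range_mfderiv_coe_sphere (n := k) u] at hmem
    exact hmem
  -- `dφ (ξ, x₂) = dφ̂ (x₁, x₂) = 0`
  have hcomp := DFunLike.congr_fun (ν.coneDeriv_comp_eq i u w)
    ((ξ, x.2) : EuclideanSpace ℝ (Fin k) × EuclideanSpace ℝ (Fin m))
  have e1 := mfderiv_hyp_apply u w ξ x.2
  have hx' : ((mfderiv (𝓡 k) 𝓘(ℝ, EuclideanSpace ℝ (Fin (k + 1)))
      (Subtype.val : Metric.sphere (0 : EuclideanSpace ℝ (Fin (k + 1))) 1 → _) u ξ, x.2) :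
      EuclideanSpace ℝ (Fin (k + 1)) × EuclideanSpace ℝ (Fin m)) = x := Prod.ext hξ rfl
  have e2 : ν.coneDeriv i u w (mfderiv ((𝓡 k).prod 𝓘(ℝ, EuclideanSpace ℝ (Fin m)))
      ((𝓘(ℝ, EuclideanSpace ℝ (Fin (k + 1)))).prod 𝓘(ℝ, EuclideanSpace ℝ (Fin m))) hyp (u, w) (ξ, x.2)) = 0 :=
    ((congrArg (ν.coneDeriv i u w) e1).trans (congrArg (ν.coneDeriv i u w) hx')).trans h0
  have h1 : mfderiv ((𝓡 k).prod 𝓘(ℝ, EuclideanSpace ℝ (Fin m))) IX (ν.toFun i) (u, w) (ξ, x.2) = 0 :=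
    hcomp.symm.trans e2
  have h2 : ((ξ, x.2) : EuclideanSpace ℝ (Fin k) × EuclideanSpace ℝ (Fin m)) = 0 :=
    ν.injective_mfderiv_toFun i (u, w) (h1.trans
      (mfderiv ((𝓡 k).prod 𝓘(ℝ, EuclideanSpace ℝ (Fin m))) IX (ν.toFun i) (u, w)).map_zero.symm)
  have hξ0 : ξ = 0 := congrArg Prod.fst h2
  have hx2 : x.2 = 0 := congrArg Prod.snd h2
  refine Prod.ext ?_ hx2
  rw [← hξ, hξ0]
  exact (mfderiv (𝓡 k) 𝓘(ℝ, EuclideanSpace ℝ (Fin (k + 1)))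
    (Subtype.val : Metric.sphere (0 : EuclideanSpace ℝ (Fin (k + 1))) 1 → _) u).map_zero

end Cone

end FramedSphereFamily

end Literature.Topology.FourManifolds

end
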